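import Literature.AlgebraicGeometry.Frobenioids.MonoidTransport
import Literature.AnabelianGeometry.EtaleTheta.Discharge.Sec3CuspidallyPureOfRankOneObject
import Literature.AnabelianGeometry.EtaleTheta.Discharge.Sec3Cor38iiiOfRlfWeak
import Literature.AnabelianGeometry.EtaleTheta.TemperedFrobenioidOfGaloisCoveringZTower
import Literature.AnabelianGeometry.EtaleTheta.TemperedFrobenioidOfTateTowerTheta

/-!
# [EtTh] Def. 3.6 (v) "cuspidally pure" for EVERY tempered Frobenioid with `Φ = im(Φ₀^pf → Φ₀^rlf)` over the weak Def. 3.6 (i)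
# data — the prime dichotomy (b) HYPOTHESIS-FREE, clause (a) reduced to ONE `Φ₀`-level binder; the multi-object engines

S. Mochizuki, *The étale theta function and its Frobenioid-theoretic manifestations*, Publ. RIMS **45** (2009)
[MochizukiEtTh2009], Def. 3.6 (v) p. 304 (PDF p. 78): "`Φ` is *cuspidally pure* if (a) for every non-cuspidal primary
element `x ∈ Φ(A)` … there exists `y ∈ Φ^{bs-fld}(A)` such that `x ≤ y`; (b) `Prime(Φ(A)) = Prime(Φ(A))^ncsp ∪
Prime(Φ(A))^csp` [disjoint union]"; Def. 3.6 (iii) p. 303 (PDF p. 77); Def. 3.1 (i) p. 296 (PDF p. 70) ("the union of the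
special fiber and divisor of cusps"); Def. 3.3 (iii) / Rmk. 3.3.1 p. 299 (PDF p. 73); Example 3.9 (iii) p. 310 (PDF p. 84)
("`Φ_W^ell` is … cuspidally pure [cf. the well-known structure of the special fibers of the 'universal combinatorial
coverings']"); [FrdI] §0 p. 12 (primary elements, primes, `≼`).  [cite: MochizukiEtTh2009, Def 3.6 p.78]
[cite: MochizukiEtTh2009, Ex 3.9 p.84] [cite: MochizukiFrdI2008, §0 p.12]

abc-iut cell, block C, abc-iut-L2-lead R889 row «DEF36v-PURITY@FULL-BASE» (after the K4 row (M6) EtTh:Prop5.1: p480266 re-keys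
F-0615 to print's Example 3.9 (iii) clause; p480739 proves Def. 3.6 (v) at every RANK-ONE object), seat abc-iut-f-128 (gen 5).
PROOF-ONLY companion (0 definitions, no instance, no new `Prop`) of abc-iut-L2-t3 / abc-iut-L6-t12's weak Def. 3.6 (i)
constructor `RealifiedDivisorMonoids.ofRlfZWeak` + support calculus + DISCHARGED disjointness (`Discharge/Sec3RealifiedCuspidal{Weak,
DisjointWeak}.lean`) and abc-iut-L2-d2's `Discharge/Sec3Cor38iiiOfRlfWeak.lean` (`eq_one_of_isNonCuspidal_of_isCuspidal_weak`,
`is(Non)Cuspidal_of_precsim_weak` — consumed BY NAME), abc-iut-w5-d179's multi-object engine `TemperedFrobenioid.ofDiagonalBase` (`TemperedFrobenioidOfDiagonalBase.lean`;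
the ℤ-tower `ZTowerTempered.temperedFrobenioid` over the FULL tempered base), abc-iut-L2-t3's engine `TemperedFrobenioid.ofGenDiagonalBase`
and **`ThetaTowerTempered.temperedFrobenioid`** (`TemperedFrobenioidOfTateTowerTheta.lean` — the `Ÿ`-skeleton WITH CUSPS over
`B^temp(Π^tp_X)⁰`, the only tempered Frobenioid of record where Def. 3.6 (v) is two-sided), and abc-iut-w5-d179's rank-one engine.
Nothing landed is edited or restated.

WHAT IS PROVED — for ANY tempered Frobenioid `C` over `ofRlfZWeak dm hpf` whose divisor monoid is print's choice
`Φ(A) = im(Φ₀(Y_A)^pf → Φ₀(Y_A)^rlf)` objectwise (`hΦ`, membership form; all three engines, by `Iff.rfl`):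
* `RealifiedDivisorMonoids.ofRlfZWeak_toR_eq_one_iff`, `…_mem_ncsp₀_of_toR_mem_ncspR` / `…_mem_csp₀_of_toR_mem_cspR` (+ `iff`s) —
  `ι(m) = 1 ⟺ m = 1`; `ι(m)` is non-cuspidal (resp. cuspidal) in `Φ₀^ℝ(Y)` iff `m` is in `Φ₀(Y)` (Def. 3.3 (iii)'s unique
  factorisation + L6-t12's disjointness `ofRlfZWeak_ncspR_inf_cspR`).
* `TemperedFrobenioid.isNonCuspidal_or_isCuspidal_of_isPrimary` — **every PRIMARY element of `Φ(A)` is non-cuspidal or cuspidal**: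
  `xⁿ = ι(m) = ι(m_ncsp)·ι(m_csp)`; if `m_ncsp = 1` then `xⁿ`, hence `x`, is cuspidal (root-closure); else `ι(m_ncsp) ≼ x` forces
  `x ≼ ι(m_ncsp)` (primality), so `x` is non-cuspidal (down-closure).
* `TemperedFrobenioid.isPrimary_of_eq_toRealification_mk` — primality descends from `x = ι(m^{1/n}) ∈ Φ(A)` to `m ∈ Φ₀(Y_A)`
  (`Φ₀(Y_A)^pf ↪ Φ(A)` with cofinal image; abc-iut-L1's `Perfection.isPrimary_of_iff` / `mk_precsim_of`).
* **`TemperedFrobenioid.isCuspidallyPure_of_pfImage`** — Def. 3.6 (v) for `C` GIVEN ONE `Φ₀`-level binder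
  `hdom : ∀ A, every PRIMARY NON-CUSPIDAL log-divisor m over Y_A divides the divisor of a constant function`
  (print: "`≤ div(p^c)`"): (a) `y := ι(div₀ b)`; (b) by the dichotomy along the `≼`-class, "not both" by disjointness.  The
  binder concerns primaries only (over `Ÿ = Π/ker φ` invariant effective divisors are unbounded along the chain).
* Engines (the rank-one case `isCuspidallyPure_ofRankOneObject` of p480739 is the instance `hdom ⟸ hcnst`):
  **`isCuspidallyPure_ofDiagonalBase`**, **`isCuspidallyPure_ofGenDiagonalBase`** (binder = `hdom` at the `F`-images), and at the
  models of record over the FULL base: **`ZTowerTempered.isCuspidallyPure_temperedFrobenioid_of_dom`**,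
  **`ThetaTowerTempered.isCuspidallyPure_temperedFrobenioid_of_dom`** (the `Ÿ`-skeleton with cusps: TWO-SIDED Def. 3.6 (v) modulo
  the displayed `Φ₀`-binder «a primary equivariant effective divisor supported on components is `≤ c·div(ϖ̈)`», abc-iut-L2-t3 /
  abc-iut-w6-d058's `LogDivisorModel` currency — not discharged here) and `ThetaTowerTempered.ncspPrimes_or_cspPrimes_temperedFrobenioid`
  (Def. 3.6 (v)(b) there with NO hypothesis).

HONEST LABEL: theorems over CONSTRUCTED / interface data; the `Φ₀`-binder of the full-base corollaries is displayed, not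
discharged; [EtTh] is refereed; nothing here bears on [IUTchIII] Cor. 3.12 — no side is taken; typed ≠ proved for anything else.
-/

noncomputable section

namespace Literature.AnabelianGeometry.EtaleTheta

open CategoryTheory Opposite Function Literature.AlgebraicGeometry.Frobenioids Literature.AnabelianGeometry.SemiGraphs

universe u₀ v₀ u v w

/-! ### 1. `ofRlfZWeak`: `ι(m)` is trivial / non-cuspidal / cuspidal iff `m` is -/

namespace RealifiedDivisorMonoids

variable {D₀ : Type u₀} [Category.{v₀} D₀] (dm : DivisorMonoids.{u₀, v₀, w} D₀)
  (hpf : ∀ Y : D₀ᵒᵖ, IsPerfFactorialCof (dm.Φ₀.obj Y))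

/-- `ι(m) = 1` in `Φ₀^ℝ(Y)` iff `m = 1` (`Φ₀(Y)^pf ↪ Φ₀(Y)^rlf`, `Φ₀(Y)` sharp). [cite: MochizukiEtTh2009, Def 3.6 p.76] -/
theorem ofRlfZWeak_toR_eq_one_iff (Y : D₀ᵒᵖ) (m : dm.Φ₀.obj Y) : (ofRlfZWeak dm hpf).toR Y m = 1 ↔ m = 1 := by
  refine ⟨fun h => ?_, fun h => by subst h; exact map_one _⟩
  have h' : (hpf Y).weak.toRealification (Perfection.of _ m) = (hpf Y).weak.toRealification 1 :=
    h.trans (map_one _).symm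
  have h1 := PfImageWeak.toRealification_injective (hpf Y).weak h'
  rwa [Perfection.of_apply, Perfection.mk_eq_one_iff_of_isSharp (hpf Y).weak.isDivisorial.isSharp] at h1

/-- **`ι(m)` non-cuspidal ⇒ `m` non-cuspidal**: the cuspidal part of `m` has image in `Φ₀^ℝ(Y)^ncsp ⊓ Φ₀^ℝ(Y)^csp = 1`
(Def. 3.3 (iii)'s factorisation; L6-t12's disjointness). [cite: MochizukiEtTh2009, Def 3.6 p.77] -/
theorem ofRlfZWeak_mem_ncsp₀_of_toR_mem_ncspR (Y : D₀ᵒᵖ) {m : dm.Φ₀.obj Y}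
    (hm : (ofRlfZWeak dm hpf).toR Y m ∈ (ofRlfZWeak dm hpf).ncspR Y) : m ∈ dm.ncsp₀ Y := by
  obtain ⟨⟨n, c⟩, hnc, -⟩ := dm.existsUnique_ncsp_csp Y m
  have hcdvd : (c : dm.Φ₀.obj Y) ∣ m := Dvd.intro_left _ hnc
  have hc : (ofRlfZWeak dm hpf).toR Y (c : dm.Φ₀.obj Y) ∈ (ofRlfZWeak dm hpf).ncspR Y :=
    ofRlfZWeak_ncspR_of_dvd dm hpf Y (map_dvd ((ofRlfZWeak dm hpf).toR Y) hcdvd) hm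
  have hc' : (ofRlfZWeak dm hpf).toR Y (c : dm.Φ₀.obj Y) ∈ (ofRlfZWeak dm hpf).cspR Y :=
    (ofRlfZWeak dm hpf).toR_csp Y (c : dm.Φ₀.obj Y) c.2
  have h1 : (ofRlfZWeak dm hpf).toR Y (c : dm.Φ₀.obj Y) = 1 := by
    have h := ofRlfZWeak_ncspR_inf_cspR dm hpf Y
    rw [eq_bot_iff] at h
    exact Submonoid.mem_bot.mp (h ⟨hc, hc'⟩)
  rw [ofRlfZWeak_toR_eq_one_iff] at h1
  rw [← hnc, h1, mul_one]
  exact n.2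

/-- Dually: **`ι(m)` cuspidal ⇒ `m` cuspidal**. [cite: MochizukiEtTh2009, Def 3.6 p.77] -/
theorem ofRlfZWeak_mem_csp₀_of_toR_mem_cspR (Y : D₀ᵒᵖ) {m : dm.Φ₀.obj Y}
    (hm : (ofRlfZWeak dm hpf).toR Y m ∈ (ofRlfZWeak dm hpf).cspR Y) : m ∈ dm.csp₀ Y := by
  obtain ⟨⟨n, c⟩, hnc, -⟩ := dm.existsUnique_ncsp_csp Y m
  have hndvd : (n : dm.Φ₀.obj Y) ∣ m := Dvd.intro _ hnc
  have hn : (ofRlfZWeak dm hpf).toR Y (n : dm.Φ₀.obj Y) ∈ (ofRlfZWeak dm hpf).cspR Y :=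
    ofRlfZWeak_cspR_of_dvd dm hpf Y (map_dvd ((ofRlfZWeak dm hpf).toR Y) hndvd) hm
  have hn' : (ofRlfZWeak dm hpf).toR Y (n : dm.Φ₀.obj Y) ∈ (ofRlfZWeak dm hpf).ncspR Y :=
    (ofRlfZWeak dm hpf).toR_ncsp Y (n : dm.Φ₀.obj Y) n.2
  have h1 : (ofRlfZWeak dm hpf).toR Y (n : dm.Φ₀.obj Y) = 1 := by
    have h := ofRlfZWeak_ncspR_inf_cspR dm hpf Y
    rw [eq_bot_iff] at h
    exact Submonoid.mem_bot.mp (h ⟨hn', hn⟩)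
  rw [ofRlfZWeak_toR_eq_one_iff] at h1
  rw [← hnc, h1, one_mul]
  exact c.2

/-- `ι(m) ∈ Φ₀^ℝ(Y)^ncsp ⟺ m ∈ Φ₀(Y)^ncsp`. [cite: MochizukiEtTh2009, Def 3.6 p.77] -/
theorem ofRlfZWeak_toR_mem_ncspR_iff (Y : D₀ᵒᵖ) (m : dm.Φ₀.obj Y) :
    (ofRlfZWeak dm hpf).toR Y m ∈ (ofRlfZWeak dm hpf).ncspR Y ↔ m ∈ dm.ncsp₀ Y :=
  ⟨ofRlfZWeak_mem_ncsp₀_of_toR_mem_ncspR dm hpf Y, (ofRlfZWeak dm hpf).toR_ncsp Y m⟩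

/-- `ι(m) ∈ Φ₀^ℝ(Y)^csp ⟺ m ∈ Φ₀(Y)^csp`. [cite: MochizukiEtTh2009, Def 3.6 p.77] -/
theorem ofRlfZWeak_toR_mem_cspR_iff (Y : D₀ᵒᵖ) (m : dm.Φ₀.obj Y) :
    (ofRlfZWeak dm hpf).toR Y m ∈ (ofRlfZWeak dm hpf).cspR Y ↔ m ∈ dm.csp₀ Y :=
  ⟨ofRlfZWeak_mem_csp₀_of_toR_mem_cspR dm hpf Y, (ofRlfZWeak dm hpf).toR_csp Y m⟩

/-- `ι(m^{1/n})ⁿ = ι(m)` in `Φ₀^ℝ(Y)`. [cite: MochizukiEtTh2009, Def 3.6 p.76] -/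
theorem ofRlfZWeak_toRealification_mk_pow (Y : D₀ᵒᵖ) (m : dm.Φ₀.obj Y) (n : ℕ+) :
    (hpf Y).weak.toRealification (Perfection.mk m n) ^ (n : ℕ) = (ofRlfZWeak dm hpf).toR Y m := by
  rw [← map_pow, Perfection.mk_pow_self]
  rfl

end RealifiedDivisorMonoids

/-! ### 2. Tempered Frobenioids with `Φ = im(Φ₀^pf → Φ₀^rlf)`: the prime dichotomy and Def. 3.6 (v) -/

namespace TemperedFrobenioid

section PfImage

variable {D₀ : Type u₀} [Category.{v₀} D₀] {dm : DivisorMonoids.{u₀, v₀, w} D₀}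
  {hpf : ∀ Y : D₀ᵒᵖ, IsPerfFactorialCof (dm.Φ₀.obj Y)}
  {D : Type u} [Category.{v} D] {VD : FrdICatStub.{u, v, w} D}
  (C : TemperedFrobenioid (RealifiedDivisorMonoids.ofRlfZWeak dm hpf) D VD)

variable (hΦ : ∀ (A : Dᵒᵖ) (x : C.ΦRlog.obj A),
    x ∈ C.Φ.carrier A ↔ ∃ a : Perfection (dm.Φ₀.obj (C.baseOp A)), (hpf (C.baseOp A)).weak.toRealification a = x)

include hΦ

/-- `ι(a) ∈ Φ(A)` for every `a ∈ Φ₀(Y_A)^pf`. [cite: MochizukiEtTh2009, Def 3.6 p.76] -/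
theorem toRealification_mem (A : Dᵒᵖ) (a : Perfection (dm.Φ₀.obj (C.baseOp A))) :
    ((hpf (C.baseOp A)).weak.toRealification a : C.ΦRlog.obj A) ∈ C.Φ.carrier A :=
  (hΦ A _).mpr ⟨a, rfl⟩

/-- Every `x ∈ Φ(A)` is `ι(m^{1/n})` for some log-divisor `m` over `Y_A` and `n ≥ 1`. [cite: MochizukiEtTh2009, Def 3.6 p.76] -/
theorem exists_eq_toRealification_mk (A : Dᵒᵖ) (x : C.Φ.carrier A) :
    ∃ (m : dm.Φ₀.obj (C.baseOp A)) (n : ℕ+),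
      (x : C.ΦRlog.obj A) = (hpf (C.baseOp A)).weak.toRealification (Perfection.mk m n) := by
  obtain ⟨a, ha⟩ := (hΦ A _).mp x.2
  obtain ⟨⟨m, n⟩, rfl⟩ := Perfection.mk_surjective a
  exact ⟨m, n, ha.symm⟩

/-- **Primality descends to `Φ₀`**: if `x = ι(m^{1/n}) ∈ Φ(A)` is primary, then `m` is primary in `Φ₀(Y_A)` (`ι` embeds
`Φ₀(Y_A)^pf` onto `Φ(A)`, and `m^{1/n} ∼ m` in the perfection). [cite: MochizukiFrdI2008, §0 p.12] -/
theorem isPrimary_of_eq_toRealification_mk (A : Dᵒᵖ) (x : C.Φ.carrier A) (hx : IsPrimary x)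
    {m : dm.Φ₀.obj (C.baseOp A)} {n : ℕ+}
    (hxm : (x : C.ΦRlog.obj A) = (hpf (C.baseOp A)).weak.toRealification (Perfection.mk m n)) : IsPrimary m := by
  have hsharp : IsSharp (dm.Φ₀.obj (C.baseOp A)) := (hpf (C.baseOp A)).weak.isDivisorial.isSharp
  have hι := PfImageWeak.toRealification_injective (hpf (C.baseOp A)).weak
  have hxe : x = ⟨_, C.toRealification_mem hΦ A (Perfection.mk m n)⟩ := Subtype.ext hxm
  subst hxe
  -- primality of `m^{1/n}` in `Φ₀(Y_A)^pf`, transported along `ι : Φ₀^pf ↪ Φ(A)` (image = `Φ(A)`)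
  have ha : IsPrimary (Perfection.mk m n) := by
    refine ⟨fun h => hx.1 (Subtype.ext ?_), fun b hb hba => ?_⟩
    · show (hpf (C.baseOp A)).weak.toRealification (Perfection.mk m n) = 1
      rw [h, map_one]
    · obtain ⟨N, hN, c, hc⟩ := hba
      -- `ι(b) ≼ x` in `Φ(A)`
      have hbx : (⟨_, C.toRealification_mem hΦ A b⟩ : C.Φ.carrier A) ≼
          ⟨_, C.toRealification_mem hΦ A (Perfection.mk m n)⟩ := by
        refine ⟨N, hN, ⟨_, C.toRealification_mem hΦ A c⟩, Subtype.ext ?_⟩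
        show (hpf (C.baseOp A)).weak.toRealification (Perfection.mk m n) ^ N =
          (hpf (C.baseOp A)).weak.toRealification b * (hpf (C.baseOp A)).weak.toRealification c
        rw [← map_pow, hc, map_mul]
      have hb1 : (⟨_, C.toRealification_mem hΦ A b⟩ : C.Φ.carrier A) ≠ 1 := by
        intro h
        have h' : (hpf (C.baseOp A)).weak.toRealification b = (1 : (hpf (C.baseOp A)).weak.Rlf) :=
          congrArg Subtype.val h
        exact hb (hι (h'.trans (map_one _).symm))
      -- primality of `x`: `x ≼ ι(b)`
      obtain ⟨K, hK, z, hz⟩ := hx.2 _ hb1 hbx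
      obtain ⟨d, hd⟩ := (hΦ A _).mp z.2
      refine ⟨K, hK, d, hι ?_⟩
      rw [map_pow, map_mul, hd]
      exact congrArg Subtype.val hz
  have hm1 : m ≠ 1 := fun h => ha.1 ((Perfection.mk_eq_one_iff_of_isSharp hsharp).mpr h)
  have hof : IsPrimary (Perfection.of _ m) :=
    ha.of_precsim (Perfection.mk_precsim_of m n).2 (by
      rw [Perfection.of_apply, Ne, Perfection.mk_eq_one_iff_of_isSharp hsharp]; exact hm1)
  exact (Perfection.isPrimary_of_iff hsharp).mp hof

omit hΦ in
/-- If `x = ι(m^{1/n})` is non-cuspidal then `m` is a non-cuspidal log-divisor (root-closure of `Φ₀^ℝ(Y)^ncsp`, then §1).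
[cite: MochizukiEtTh2009, Def 3.6 p.77] -/
theorem mem_ncsp₀_of_isNonCuspidal (A : Dᵒᵖ) (x : C.Φ.carrier A) (hnc : C.IsNonCuspidal x)
    {m : dm.Φ₀.obj (C.baseOp A)} {n : ℕ+}
    (hxm : (x : C.ΦRlog.obj A) = (hpf (C.baseOp A)).weak.toRealification (Perfection.mk m n)) :
    m ∈ dm.ncsp₀ (C.baseOp A) := by
  apply RealifiedDivisorMonoids.ofRlfZWeak_mem_ncsp₀_of_toR_mem_ncspR dm hpf (C.baseOp A)
  rw [← RealifiedDivisorMonoids.ofRlfZWeak_toRealification_mk_pow dm hpf (C.baseOp A) m n]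
  apply (RealifiedDivisorMonoids.ofRlfZWeak_pow_mem_ncspR_iff dm hpf (C.baseOp A) _ n.ne_zero).mpr
  have h : (x : C.ΦRlog.obj A) ∈ (RealifiedDivisorMonoids.ofRlfZWeak dm hpf).ncspR (C.baseOp A) := hnc
  rw [hxm] at h
  exact h

/-- **Every primary element of `Φ(A)` is non-cuspidal or cuspidal** (Def. 3.6 (iii)): with `x = ι(m^{1/n})`,
`m = m_ncsp · m_csp` (Def. 3.3 (iii)); if `m_ncsp = 1` then `xⁿ = ι(m) ∈ Φ₀^ℝ^csp`, so `x` is cuspidal (root-closure); otherwise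
`ι(m_ncsp) ≠ 1` divides `xⁿ`, so by primality `x ∣ ι(m_ncsp)^N ∈ Φ₀^ℝ^ncsp` and `x` is non-cuspidal (down-closure).
[cite: MochizukiEtTh2009, Def 3.6 p.77] -/
theorem isNonCuspidal_or_isCuspidal_of_isPrimary (A : Dᵒᵖ) (x : C.Φ.carrier A) (hx : IsPrimary x) :
    C.IsNonCuspidal x ∨ C.IsCuspidal x := by
  obtain ⟨m, n, hxm⟩ := C.exists_eq_toRealification_mk hΦ A x
  have hxe : x = ⟨_, C.toRealification_mem hΦ A (Perfection.mk m n)⟩ := Subtype.ext hxm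
  subst hxe
  obtain ⟨⟨m₁, m₂⟩, hm, -⟩ := dm.existsUnique_ncsp_csp (C.baseOp A) m
  dsimp only at hm
  by_cases h1 : (m₁ : dm.Φ₀.obj (C.baseOp A)) = 1
  · -- `m` is cuspidal: `xⁿ = ι(m) ∈ Φ₀^ℝ^csp`, hence `x` is (root-closure)
    right
    have hm₂ : m = (m₂ : dm.Φ₀.obj (C.baseOp A)) := by rw [← hm, h1, one_mul]
    show (hpf (C.baseOp A)).weak.toRealification (Perfection.mk m n) ∈
      (RealifiedDivisorMonoids.ofRlfZWeak dm hpf).cspR (C.baseOp A)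
    apply (RealifiedDivisorMonoids.ofRlfZWeak_pow_mem_cspR_iff dm hpf (C.baseOp A) _ n.ne_zero).mp
    rw [RealifiedDivisorMonoids.ofRlfZWeak_toRealification_mk_pow, hm₂]
    exact (RealifiedDivisorMonoids.ofRlfZWeak dm hpf).toR_csp _ _ m₂.2
  · -- `ι(m₁) ≼ x`, hence `x ≼ ι(m₁)` by primality, so `x` is non-cuspidal (down-closure)
    left
    have hm₁mem := C.toRealification_mem hΦ A (Perfection.of _ (m₁ : dm.Φ₀.obj (C.baseOp A)))
    have hm₂mem := C.toRealification_mem hΦ A (Perfection.of _ (m₂ : dm.Φ₀.obj (C.baseOp A)))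
    have hb1 : (⟨_, hm₁mem⟩ : C.Φ.carrier A) ≠ 1 := by
      intro h
      have h' : (hpf (C.baseOp A)).weak.toRealification (Perfection.of _ (m₁ : dm.Φ₀.obj (C.baseOp A))) =
          (1 : (hpf (C.baseOp A)).weak.Rlf) := congrArg Subtype.val h
      exact h1 ((RealifiedDivisorMonoids.ofRlfZWeak_toR_eq_one_iff dm hpf (C.baseOp A) _).mp h')
    have hbx : (⟨_, hm₁mem⟩ : C.Φ.carrier A) ≼ ⟨_, C.toRealification_mem hΦ A (Perfection.mk m n)⟩ := by
      refine ⟨n, n.pos, ⟨_, hm₂mem⟩, Subtype.ext ?_⟩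
      show (hpf (C.baseOp A)).weak.toRealification (Perfection.mk m n) ^ (n : ℕ) =
        (hpf (C.baseOp A)).weak.toRealification (Perfection.of _ (m₁ : dm.Φ₀.obj (C.baseOp A))) *
          (hpf (C.baseOp A)).weak.toRealification (Perfection.of _ (m₂ : dm.Φ₀.obj (C.baseOp A)))
      rw [← map_pow, Perfection.mk_pow_self, ← map_mul, ← map_mul, hm]
    obtain ⟨N, -, hN⟩ := hx.2 _ hb1 hbx
    have hbN : (hpf (C.baseOp A)).weak.toRealification (Perfection.of _ (m₁ : dm.Φ₀.obj (C.baseOp A))) ^ N ∈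
        (RealifiedDivisorMonoids.ofRlfZWeak dm hpf).ncspR (C.baseOp A) :=
      pow_mem ((RealifiedDivisorMonoids.ofRlfZWeak dm hpf).toR_ncsp _ _ m₁.2) N
    have hdvd : (hpf (C.baseOp A)).weak.toRealification (Perfection.mk m n) ∣
        (hpf (C.baseOp A)).weak.toRealification (Perfection.of _ (m₁ : dm.Φ₀.obj (C.baseOp A))) ^ N :=
      map_dvd (C.Φ.carrier A).subtype hN
    exact RealifiedDivisorMonoids.ofRlfZWeak_ncspR_of_dvd dm hpf (C.baseOp A) hdvd hbN

/-- **Def. 3.6 (v)(b) HYPOTHESIS-FREE**: every prime of `Φ(A)` is non-cuspidal or cuspidal, and not both.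
[cite: MochizukiEtTh2009, Def 3.6 p.78] -/
theorem ncspPrimes_or_cspPrimes (A : Dᵒᵖ) (𝔭 : Primes (C.Φ.carrier A)) :
    (𝔭 ∈ C.ncspPrimes A ∨ 𝔭 ∈ C.cspPrimes A) ∧ ¬ (𝔭 ∈ C.ncspPrimes A ∧ 𝔭 ∈ C.cspPrimes A) := by
  obtain ⟨⟨x, hxP⟩, rfl⟩ := Quotient.mk_surjective 𝔭
  have hxmem : x ∈ Primes.carrier (Quotient.mk (primarySetoid _) ⟨x, hxP⟩) := ⟨hxP, rfl⟩
  have hcls : ∀ z ∈ Primes.carrier (Quotient.mk (primarySetoid _) ⟨x, hxP⟩), z ≼ x := by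
    rintro z ⟨hz, hzx⟩
    exact Quotient.exact hzx
  refine ⟨?_, fun h => hxP.1 (C.eq_one_of_isNonCuspidal_of_isCuspidal_weak x (h.1 x hxmem) (h.2 x hxmem))⟩
  rcases C.isNonCuspidal_or_isCuspidal_of_isPrimary hΦ A x hxP with hx | hx
  · exact Or.inl fun z hz => C.isNonCuspidal_of_precsim_weak (hcls z hz) hx
  · exact Or.inr fun z hz => C.isCuspidal_of_precsim_weak (hcls z hz) hx

/-- **Def. 3.6 (v) for every tempered Frobenioid with `Φ = im(Φ₀^pf → Φ₀^rlf)` over `ofRlfZWeak dm hpf`**, GIVEN the one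
`Φ₀`-level clause `hdom`: every PRIMARY NON-CUSPIDAL log-divisor `m` over `Y_A` divides the divisor `div₀ b` of a constant
function `b ∈ F₀(Y_A)` (print: "`≤ div(p^c)`").  Then (a): a non-cuspidal primary `x = ι(m^{1/n})` has `m` primary
(`isPrimary_of_eq_toRealification_mk`) and non-cuspidal (`mem_ncsp₀_of_isNonCuspidal`), and
`x ≤ xⁿ = ι(m) ≤ ι(div₀ b) =: y ∈ Φ^{bs-fld}(A)` (`Φ₀^cnst ⊆ ℝ·Φ₀^cnst`); (b): `ncspPrimes_or_cspPrimes`.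
[cite: MochizukiEtTh2009, Def 3.6 p.78] -/
theorem isCuspidallyPure_of_pfImage
    (hdom : ∀ (A : Dᵒᵖ) (m : dm.Φ₀.obj (C.baseOp A)), m ∈ dm.ncsp₀ (C.baseOp A) → IsPrimary m →
      ∃ b ∈ dm.F₀ (C.baseOp A), ∃ k : dm.Φ₀.obj (C.baseOp A),
        dm.div₀ (C.baseOp A) b = Algebra.GrothendieckGroup.of (m * k)) :
    C.IsCuspidallyPure where
  exists_bsFld_dvd A x hx hnc := by
    obtain ⟨m, n, hxm⟩ := C.exists_eq_toRealification_mk hΦ A x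
    have hprim : IsPrimary m := C.isPrimary_of_eq_toRealification_mk hΦ A x hx hxm
    have hncsp : m ∈ dm.ncsp₀ (C.baseOp A) := C.mem_ncsp₀_of_isNonCuspidal A x hnc hxm
    have hxe : x = ⟨_, C.toRealification_mem hΦ A (Perfection.mk m n)⟩ := Subtype.ext hxm
    subst hxe
    obtain ⟨b, hb, k, hbk⟩ := hdom A m hncsp hprim
    refine ⟨⟨_, C.toRealification_mem hΦ A (Perfection.of _ (m * k))⟩, ?_, ?_⟩
    · -- base-field-theoretic: `[ι(m·k)] = ι(div₀ b) ∈ ℝ·Φ₀^cnst`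
      refine Submonoid.mem_inf.mpr ⟨C.toRealification_mem hΦ A _, Submonoid.mem_comap.mpr ?_⟩
      have h : gpMap ((RealifiedDivisorMonoids.ofRlfZWeak dm hpf).toR (C.baseOp A))
          ((RealifiedDivisorMonoids.ofRlfZWeak dm hpf).div₀ (C.baseOp A) b) ∈
          (RealifiedDivisorMonoids.ofRlfZWeak dm hpf).cnstR (C.baseOp A) :=
        (RealifiedDivisorMonoids.ofRlfZWeak dm hpf).cnst_le_cnstR (C.baseOp A) b hb
      have h2 : gpMap ((RealifiedDivisorMonoids.ofRlfZWeak dm hpf).toR (C.baseOp A))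
          ((RealifiedDivisorMonoids.ofRlfZWeak dm hpf).div₀ (C.baseOp A) b) =
          Algebra.GrothendieckGroup.of ((RealifiedDivisorMonoids.ofRlfZWeak dm hpf).toR (C.baseOp A) (m * k)) := by
        have hbk' : (RealifiedDivisorMonoids.ofRlfZWeak dm hpf).div₀ (C.baseOp A) b =
            @Algebra.GrothendieckGroup.of ((RealifiedDivisorMonoids.ofRlfZWeak dm hpf).Φ₀.obj (C.baseOp A)) _ (m * k) := hbk
        rw [hbk']
        exact gpMap_of _ _
      rw [h2] at h
      exact h
    · -- `x ∣ xⁿ = ι(m) ∣ ι(m·k)`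
      refine dvd_trans (dvd_pow_self _ n.ne_zero) ⟨⟨_, C.toRealification_mem hΦ A (Perfection.of _ k)⟩, Subtype.ext ?_⟩
      show (hpf (C.baseOp A)).weak.toRealification (Perfection.of _ (m * k)) =
        (hpf (C.baseOp A)).weak.toRealification (Perfection.mk m n) ^ (n : ℕ) *
          (hpf (C.baseOp A)).weak.toRealification (Perfection.of _ k)
      rw [← map_pow, Perfection.mk_pow_self, ← map_mul, ← map_mul]
  ncsp_or_csp A 𝔭 := (C.ncspPrimes_or_cspPrimes hΦ A 𝔭).1
  not_ncsp_and_csp A 𝔭 := (C.ncspPrimes_or_cspPrimes hΦ A 𝔭).2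

end PfImage

/-! ### 3. The engines -/


section Diagonal

variable {D₀ : Type u₀} [Category.{v₀} D₀] {dm : DivisorMonoids.{u₀, v₀, 0} D₀}
  (hpf : ∀ Y : D₀ᵒᵖ, IsPerfFactorialCof (dm.Φ₀.obj Y)) {D : Type u} [Category.{v} D]
  (hD : IsConnected D) (hD' : IsTotallyEpimorphic D) (hFSM : IsOfFSMType D) (R S : (Dᵒᵖ ⥤ CommMonCat.{0}) → Prop)

/-- **Def. 3.6 (v) for abc-iut-w5-d179's multi-object engine `ofDiagonalBase`** (higher-rank `Φ₀`, `Φ^{bs-fld} = ι(⟨d_A⟩^pf)`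
proper): (b) hypothesis-free; (a) GIVEN `hdom` at the `F`-images. [cite: MochizukiEtTh2009, Def 3.6 p.78] -/
theorem isCuspidallyPure_ofDiagonalBase (P : DiagonalBase dm D)
    (hdom : ∀ (A : Dᵒᵖ) (m : dm.Φ₀.obj (op (P.F.obj (unop A)))), m ∈ dm.ncsp₀ _ → IsPrimary m →
      ∃ b ∈ dm.F₀ (op (P.F.obj (unop A))), ∃ k : dm.Φ₀.obj (op (P.F.obj (unop A))),
        dm.div₀ _ b = Algebra.GrothendieckGroup.of (m * k)) :
    (ofDiagonalBase hpf P hD hD' hFSM R S).IsCuspidallyPure :=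
  (ofDiagonalBase hpf P hD hD' hFSM R S).isCuspidallyPure_of_pfImage (fun _ _ => Iff.rfl) hdom

/-- **Def. 3.6 (v) for abc-iut-L2-t3's engine `ofGenDiagonalBase`** (pattern diagonal; the `Ÿ`-skeleton's engine): (b)
hypothesis-free; (a) GIVEN `hdom` at the `F`-images. [cite: MochizukiEtTh2009, Def 3.6 p.78] -/
theorem isCuspidallyPure_ofGenDiagonalBase (P : GenDiagonalBase dm D)
    (hdom : ∀ (A : Dᵒᵖ) (m : dm.Φ₀.obj (op (P.F.obj (unop A)))), m ∈ dm.ncsp₀ _ → IsPrimary m →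
      ∃ b ∈ dm.F₀ (op (P.F.obj (unop A))), ∃ k : dm.Φ₀.obj (op (P.F.obj (unop A))),
        dm.div₀ _ b = Algebra.GrothendieckGroup.of (m * k)) :
    (ofGenDiagonalBase hpf P hD hD' hFSM R S).IsCuspidallyPure :=
  (ofGenDiagonalBase hpf P hD hD' hFSM R S).isCuspidallyPure_of_pfImage (fun _ _ => Iff.rfl) hdom

end Diagonal

end TemperedFrobenioid

/-! ### 4. The models of record over the FULL tempered base -/

namespace ZTowerTempered

variable {K : Type} [Field K] (X : SemiGraphs.TemperedArithmeticGroup.{0} K) (φ : X.Pi →* Multiplicative ℤ)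
  (R S : ((ConnectedPart (BTemp X.Pi))ᵒᵖ ⥤ CommMonCat.{0}) → Prop)

/-- **Def. 3.6 (v) at abc-iut-w5-d179's ℤ-TOWER tempered Frobenioid over the FULL base `B^temp(Π^tp_X)⁰`** (chain-only skeleton:
every divisor non-cuspidal, higher-rank `Φ₀`): (b) hypothesis-free; (a) GIVEN the `Φ₀`-clause «a primary (non-cuspidal) equivariant
effective divisor over `Y_A` divides `div(ϖᶜ)`». [cite: MochizukiEtTh2009, Def 3.6 p.78] -/
theorem isCuspidallyPure_temperedFrobenioid_of_dom
    (hdom : ∀ (A : (ConnectedPart (BTemp X.Pi))ᵒᵖ) (m : (dm X φ).Φ₀.obj (op ((diagonalBase X φ).F.obj (unop A)))),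
      m ∈ (dm X φ).ncsp₀ _ → IsPrimary m →
      ∃ b ∈ (dm X φ).F₀ (op ((diagonalBase X φ).F.obj (unop A))),
        ∃ k : (dm X φ).Φ₀.obj (op ((diagonalBase X φ).F.obj (unop A))),
        (dm X φ).div₀ _ b = Algebra.GrothendieckGroup.of (m * k)) :
    (temperedFrobenioid X φ R S).IsCuspidallyPure :=
  TemperedFrobenioid.isCuspidallyPure_ofDiagonalBase (hpf X φ) _ _ _ R S (diagonalBase X φ) hdom

end ZTowerTempered

namespace ThetaTowerTempered

variable {K : Type} [Field K] (X : SemiGraphs.TemperedArithmeticGroup.{0} K) (φ : X.Pi →* Multiplicative ℤ)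
  (R S : ((ConnectedPart (BTemp X.Pi))ᵒᵖ ⥤ CommMonCat.{0}) → Prop)

/-- **Def. 3.6 (v), TWO-SIDED, at abc-iut-L2-t3's tempered Frobenioid of the `Ÿ`-skeleton WITH CUSPS over `B^temp(Π^tp_X)⁰`**:
the prime dichotomy (b) — every prime of `Φ(A)` is a component-orbit prime (non-cuspidal) or a cusp-orbit prime (cuspidal), never
both — is a THEOREM; clause (a) holds GIVEN the `Φ₀`-clause «a primary equivariant effective divisor supported on components
divides `div(ϖ̈ᶜ)`» (displayed, `LogDivisorModel` currency). [cite: MochizukiEtTh2009, Def 3.6 p.78] -/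
theorem isCuspidallyPure_temperedFrobenioid_of_dom
    (hdom : ∀ (A : (ConnectedPart (BTemp X.Pi))ᵒᵖ) (m : (dm X φ).Φ₀.obj (op ((genDiagonalBase X φ).F.obj (unop A)))),
      m ∈ (dm X φ).ncsp₀ _ → IsPrimary m →
      ∃ b ∈ (dm X φ).F₀ (op ((genDiagonalBase X φ).F.obj (unop A))),
        ∃ k : (dm X φ).Φ₀.obj (op ((genDiagonalBase X φ).F.obj (unop A))),
        (dm X φ).div₀ _ b = Algebra.GrothendieckGroup.of (m * k)) :
    (temperedFrobenioid X φ R S).IsCuspidallyPure :=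
  TemperedFrobenioid.isCuspidallyPure_ofGenDiagonalBase (hpf X φ) _ _ _ R S (genDiagonalBase X φ) hdom

/-- **Def. 3.6 (v)(b) at the `Ÿ`-skeleton WITH NO HYPOTHESIS**: every prime of the divisor monoid over every connected tempered
covering is non-cuspidal or cuspidal, and not both. [cite: MochizukiEtTh2009, Def 3.6 p.78] -/
theorem ncspPrimes_or_cspPrimes_temperedFrobenioid (A : (ConnectedPart (BTemp X.Pi))ᵒᵖ)
    (𝔭 : Primes ((temperedFrobenioid X φ R S).Φ.carrier A)) :
    (𝔭 ∈ (temperedFrobenioid X φ R S).ncspPrimes A ∨ 𝔭 ∈ (temperedFrobenioid X φ R S).cspPrimes A) ∧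
      ¬ (𝔭 ∈ (temperedFrobenioid X φ R S).ncspPrimes A ∧ 𝔭 ∈ (temperedFrobenioid X φ R S).cspPrimes A) :=
  (temperedFrobenioid X φ R S).ncspPrimes_or_cspPrimes (fun _ _ => Iff.rfl) A 𝔭

end ThetaTowerTempered

end Literature.AnabelianGeometry.EtaleTheta

end
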